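import Summits.NavierStokesRegularity.FunctionalMining.NoGo.TopEigHeatVariance
import HarnessLib

/-!
# FunctionalMining / NoGo — K53c: NO CONCENTRATION for (F2) witnesses on `T³`
# `16π²(q−1)/q · (1 − vol{λ₁ > 0}) · Φ_q(v) ≤ heatDissipation Φ_q v`, real `q ≥ 2`

HONEST FRAMING. Search for candidate a priori estimates; no regularity claim. Nothing about
Navier–Stokes is proved or asserted in this file. Cell `pub-nsfunc`, no-go seat (gen 51, touch 3).
Static calculus of smooth fields on the flat torus.

CONTEXT. Door (b)/(F2) of `NOGO.md` is the WANTED kernel negation `¬ TopEigHeatCoercivePos q` of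
the open node Lemma L-λ(q) (a KILLING FAMILY with `heatDissipation Φ_q v_n / Φ_q v_n → 0`,
`Φ_q = torusTopEigMoment q = ∫ (λ₁⁺)^q`, `λ₁ = torusStrainTopEig v`). K53b
(`NoGo/TopEigHeatVariance`, imported) proves the RATE–VARIANCE RULE
`16π²(q−1)/q · (Φ_q − Φ_{q/2}²) ≤ heatDissipation Φ_q v` on `T³` for every real `q ≥ 2`.

CONTENT. § 1 (any `d`, `q > 0`, `v` smooth): if `λ₁ ≤ 0` off a measurable set `A` then
`Φ_{q/2}(v)² ≤ vol(A) · Φ_q(v)` — Cauchy–Schwarz for `1_A · (λ₁⁺)^{q/2}` (Mathlib Hölder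
`integral_mul_le_Lp_mul_Lq_of_nonneg`). § 2 (`T³`, real `q ≥ 2`, `v` smooth divergence-free):
**`one_sub_measureReal_mul_moment_le_heatDissipation`**
`16π²(q−1)/q · (1 − vol A) · Φ_q(v) ≤ heatDissipation Φ_q v`, in particular with `A = {λ₁ > 0}`;
the uniform price **`sparse_price_le_heatDissipation`** `16π²(q−1)/q · (1 − θ) · Φ_q(v) ≤
heatDissipation Φ_q v` on the class `vol{λ₁ > 0} ≤ θ`; and the filling bound
**`one_sub_ratio_le_measureReal_pos`**
`1 − q/(16π²(q−1)) · heatDissipation Φ_q v / Φ_q(v) ≤ vol{λ₁ > 0}` (`Φ_q(v) > 0`).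

MEANING FOR (F2) (design rule (R12′), records only). NO CONCENTRATION: a killing family for
L-λ(q), `q ≥ 2`, has `vol{λ₁(S_{v_n}) > 0} → 1` — the top strain eigenvalue must be positive on
asymptotically ALL of `T³`; every design whose strain-active region occupies a fraction `≤ θ < 1`
of the torus (bubbles, tubes, sheets, sparse laminates, rescaled compactly supported profiles) is
coercively priced with the explicit constant `16π²(q−1)(1−θ)/q`, uniformly in the design. NOT
here: `1 < q < 2`, `q = 1`, any verdict change — L-λ(q) OPEN for all real `q > 1`; no 𝒦₀ row, no
A12 count, no T_LD input. [ours]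
FILING (prove seat g29, REQUEST #81): declarations byte-identical to the no-go seat's staged `TopEigHeatNoConcentration.STAGING.lean` 50c3f71e1d91c21c; this line is the only addition.
-/

noncomputable section
open MeasureTheory Set Filter Topology Metric Function
open scoped Convolution InnerProductSpace NNReal ENNReal

namespace Summit.NavierStokesRegularity.FunctionalMining

open MeasureTheory Set Filter Topology
open Literature.Analysis.FunctionSpaces Literature.Analysis.FunctionSpaces.Torus
  Literature.Analysis.FluidPDE

namespace TopEig

namespace Variance

/-! ## § 1 Cauchy–Schwarz on the support of `λ₁⁺` (any `d`) -/

section Support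

variable {d : Type*} [Fintype d] [DecidableEq d] [Nonempty d]
  {v : UnitAddTorus d → EuclideanSpace ℝ d} {q : ℝ}

/-- `Φ_{q/2}(v)² ≤ vol(A) · Φ_q(v)` whenever `λ₁ ≤ 0` off the measurable set `A` (`q > 0`, `v`
smooth): Cauchy–Schwarz for `1_A · (λ₁⁺)^{q/2}`. [ours; Hölder is Mathlibʼs
`integral_mul_le_Lp_mul_Lq_of_nonneg`] -/
theorem sq_topEigMoment_half_le_measureReal_mul (hv : Torus.IsSmooth v) (hq : 0 < q)
    {A : Set (UnitAddTorus d)} (hA : MeasurableSet A)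
    (hAv : ∀ x, x ∉ A → torusStrainTopEig v x ≤ 0) :
    torusTopEigMoment (q / 2) v ^ 2 ≤ volume.real A * torusTopEigMoment q v := by
  set g : UnitAddTorus d → ℝ := fun x => (max (torusStrainTopEig v x) 0) ^ (q / 2) with hg
  have hgc : Continuous g :=
    ((continuous_torusStrainTopEig hv).max continuous_const).rpow_const fun _ => Or.inr (by linarith)
  have hgnn : ∀ x, 0 ≤ g x := fun x => Real.rpow_nonneg (le_max_right _ _) _
  have hg0 : ∀ x, x ∉ A → g x = 0 := fun x hx => by
    simp only [hg, max_eq_right (hAv x hx), Real.zero_rpow (div_pos hq two_pos).ne']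
  have hg2 : ∀ x, g x ^ (2 : ℝ) = (max (torusStrainTopEig v x) 0) ^ q := fun x => by
    simp only [hg]
    rw [← Real.rpow_mul (le_max_right _ _)]
    congr 1
    ring
  set f : UnitAddTorus d → ℝ := A.indicator 1 with hf
  have hfm : Measurable f := measurable_one.indicator hA
  have hf01 : ∀ x, f x = 0 ∨ f x = 1 := fun x => by
    by_cases hx : x ∈ A
    · exact Or.inr (by simp [hf, hx])
    · exact Or.inl (by simp [hf, hx])
  have hfnn : ∀ x, 0 ≤ f x := fun x => by rcases hf01 x with h | h <;> simp [h]
  have hfle : ∀ x, ‖f x‖ ≤ 1 := fun x => by rcases hf01 x with h | h <;> simp [h]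
  have hfg : ∀ x, f x * g x = g x := fun x => by
    by_cases hx : x ∈ A
    · simp [hf, hx]
    · rw [hg0 x hx, mul_zero]
  have hf2 : ∀ x, f x ^ (2 : ℝ) = f x := fun x => by
    rcases hf01 x with h | h <;> simp [h, Real.zero_rpow two_ne_zero]
  obtain ⟨M, hM⟩ : ∃ M : ℝ, ∀ x, ‖g x‖ ≤ M := by
    obtain ⟨M, hM⟩ := isCompact_univ.exists_bound_of_continuousOn hgc.continuousOn
    exact ⟨M, fun x => hM x (mem_univ x)⟩
  have hgLp : MemLp g (ENNReal.ofReal 2) volume :=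
    MemLp.of_bound hgc.aestronglyMeasurable M (Eventually.of_forall hM)
  have hfLp : MemLp f (ENNReal.ofReal 2) volume :=
    MemLp.of_bound hfm.aestronglyMeasurable 1 (Eventually.of_forall hfle)
  have hH := integral_mul_le_Lp_mul_Lq_of_nonneg Real.HolderConjugate.two_two
    (Eventually.of_forall hfnn) (Eventually.of_forall hgnn) hfLp hgLp
  simp only [hfg, hf2, hg2] at hH
  rw [hf, integral_indicator_one hA, ← Real.sqrt_eq_rpow, ← Real.sqrt_eq_rpow] at hH
  have hΦ1 : torusTopEigMoment (q / 2) v = ∫ x, g x := rfl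
  have hΦ2 : torusTopEigMoment q v = ∫ x, (max (torusStrainTopEig v x) 0) ^ q := rfl
  have hΦnn : 0 ≤ torusTopEigMoment (q / 2) v := hΦ1 ▸ integral_nonneg hgnn
  have hΦq0 : 0 ≤ torusTopEigMoment q v :=
    hΦ2 ▸ integral_nonneg fun x => Real.rpow_nonneg (le_max_right _ _) _
  rw [← hΦ1, ← hΦ2] at hH
  calc torusTopEigMoment (q / 2) v ^ 2
      ≤ (Real.sqrt (volume.real A) * Real.sqrt (torusTopEigMoment q v)) ^ 2 :=
        pow_le_pow_left₀ hΦnn hH 2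
    _ = volume.real A * torusTopEigMoment q v := by
        rw [mul_pow, Real.sq_sqrt measureReal_nonneg, Real.sq_sqrt hΦq0]

end Support

/-! ## § 2 No concentration on `T³` -/

section NoConcentration

variable {v : UnitAddTorus (Fin 3) → EuclideanSpace ℝ (Fin 3)} {q : ℝ}

/-- **NO CONCENTRATION.** Real `q ≥ 2`, `v` smooth divergence-free on `T³`, `λ₁ ≤ 0` off a
measurable set `A`: `16π²(q−1)/q · (1 − vol A) · Φ_q(v) ≤ heatDissipation Φ_q v` — the
rate–variance rule (K53b `rate_moments_le_heatDissipation`) and § 1. [ours] -/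
theorem one_sub_measureReal_mul_moment_le_heatDissipation (hq : 2 ≤ q) (hv : Torus.IsSmooth v)
    (hdv : Torus.IsDivFree v) {A : Set (UnitAddTorus (Fin 3))} (hA : MeasurableSet A)
    (hAv : ∀ x, x ∉ A → torusStrainTopEig v x ≤ 0) :
    16 * Real.pi ^ 2 * (q - 1) / q * (1 - volume.real A) * torusTopEigMoment q v ≤
      heatDissipation (torusTopEigMoment q) v := by
  have h1 := rate_moments_le_heatDissipation hq hv hdv
  have hq0 : 0 < q := by linarith
  have h2 := sq_topEigMoment_half_le_measureReal_mul hv hq0 hA hAv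
  have hq1 : 0 ≤ q - 1 := by linarith
  have hc : 0 ≤ 16 * Real.pi ^ 2 * (q - 1) / q :=
    div_nonneg (mul_nonneg (by positivity) hq1) (by linarith)
  calc 16 * Real.pi ^ 2 * (q - 1) / q * (1 - volume.real A) * torusTopEigMoment q v
      = 16 * Real.pi ^ 2 * (q - 1) / q *
          (torusTopEigMoment q v - volume.real A * torusTopEigMoment q v) := by ring
    _ ≤ 16 * Real.pi ^ 2 * (q - 1) / q *
          (torusTopEigMoment q v - torusTopEigMoment (q / 2) v ^ 2) :=
        mul_le_mul_of_nonneg_left (by linarith) hc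
    _ ≤ heatDissipation (torusTopEigMoment q) v := h1

/-- With `A = {λ₁ > 0}`: `16π²(q−1)/q · (1 − vol{λ₁ > 0}) · Φ_q(v) ≤ heatDissipation Φ_q v`
(real `q ≥ 2`, `v` smooth divergence-free on `T³`). [ours] -/
theorem one_sub_measureReal_pos_mul_moment_le_heatDissipation (hq : 2 ≤ q)
    (hv : Torus.IsSmooth v) (hdv : Torus.IsDivFree v) :
    16 * Real.pi ^ 2 * (q - 1) / q * (1 - volume.real {x | 0 < torusStrainTopEig v x}) *
        torusTopEigMoment q v ≤
      heatDissipation (torusTopEigMoment q) v :=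
  one_sub_measureReal_mul_moment_le_heatDissipation hq hv hdv
    (measurableSet_lt measurable_const (continuous_torusStrainTopEig hv).measurable)
    fun _ hx => not_lt.1 hx

/-- **Uniform price on sparse designs.** If the strain-active region `{λ₁ > 0}` has volume `≤ θ`,
then `16π²(q−1)/q · (1 − θ) · Φ_q(v) ≤ heatDissipation Φ_q v` (real `q ≥ 2`): on the class
`vol{λ₁ > 0} ≤ θ < 1` the functional `Φ_q` is heat-coercive with an explicit constant. [ours] -/
theorem sparse_price_le_heatDissipation (hq : 2 ≤ q) (hv : Torus.IsSmooth v)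
    (hdv : Torus.IsDivFree v) {θ : ℝ}
    (hθ : volume.real {x | 0 < torusStrainTopEig v x} ≤ θ) :
    16 * Real.pi ^ 2 * (q - 1) / q * (1 - θ) * torusTopEigMoment q v ≤
      heatDissipation (torusTopEigMoment q) v := by
  have h := one_sub_measureReal_pos_mul_moment_le_heatDissipation hq hv hdv
  have hq1 : 0 ≤ q - 1 := by linarith
  have hc : 0 ≤ 16 * Real.pi ^ 2 * (q - 1) / q :=
    div_nonneg (mul_nonneg (by positivity) hq1) (by linarith)
  have hΦ : 0 ≤ torusTopEigMoment q v :=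
    integral_nonneg fun x => Real.rpow_nonneg (le_max_right _ _) _
  calc 16 * Real.pi ^ 2 * (q - 1) / q * (1 - θ) * torusTopEigMoment q v
      ≤ 16 * Real.pi ^ 2 * (q - 1) / q * (1 - volume.real {x | 0 < torusStrainTopEig v x}) *
          torusTopEigMoment q v :=
        mul_le_mul_of_nonneg_right (mul_le_mul_of_nonneg_left (by linarith) hc) hΦ
    _ ≤ heatDissipation (torusTopEigMoment q) v := h

/-- **(R12′) KILLING FAMILIES FILL THE TORUS.** `Φ_q(v) > 0`, real `q ≥ 2`, `v` smooth
divergence-free on `T³`: `1 − q/(16π²(q−1)) · heatDissipation Φ_q v / Φ_q(v) ≤ vol{λ₁ > 0}`; along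
a killing family (`heatDissipation Φ_q v_n / Φ_q v_n → 0`) the strain-active volume tends to `1`.
[ours] -/
theorem one_sub_ratio_le_measureReal_pos (hq : 2 ≤ q) (hv : Torus.IsSmooth v)
    (hdv : Torus.IsDivFree v) (hΦ : 0 < torusTopEigMoment q v) :
    1 - q / (16 * Real.pi ^ 2 * (q - 1)) *
        (heatDissipation (torusTopEigMoment q) v / torusTopEigMoment q v) ≤
      volume.real {x | 0 < torusStrainTopEig v x} := by
  have h := one_sub_measureReal_pos_mul_moment_le_heatDissipation hq hv hdv
  have hq0 : q ≠ 0 := by positivity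
  have hq1 : 0 < q - 1 := by linarith
  have hπ : Real.pi ≠ 0 := Real.pi_ne_zero
  have hc : 0 < 16 * Real.pi ^ 2 * (q - 1) / q := by positivity
  have h' : 1 - volume.real {x | 0 < torusStrainTopEig v x} ≤
      heatDissipation (torusTopEigMoment q) v /
        (16 * Real.pi ^ 2 * (q - 1) / q * torusTopEigMoment q v) := by
    rw [le_div_iff₀ (mul_pos hc hΦ)]
    calc (1 - volume.real {x | 0 < torusStrainTopEig v x}) *
          (16 * Real.pi ^ 2 * (q - 1) / q * torusTopEigMoment q v)
        = 16 * Real.pi ^ 2 * (q - 1) / q * (1 - volume.real {x | 0 < torusStrainTopEig v x}) *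
            torusTopEigMoment q v := by ring
      _ ≤ heatDissipation (torusTopEigMoment q) v := h
  have e : heatDissipation (torusTopEigMoment q) v /
        (16 * Real.pi ^ 2 * (q - 1) / q * torusTopEigMoment q v) =
      q / (16 * Real.pi ^ 2 * (q - 1)) *
        (heatDissipation (torusTopEigMoment q) v / torusTopEigMoment q v) := by
    field_simp
  linarith [h', e]

end NoConcentration

end Variance

end TopEig

end Summit.NavierStokesRegularity.FunctionalMining
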